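import Summits.MatrixMultiplication.OmegaCensus.STPP222IcosetWSearch
import Summits.MatrixMultiplication.OmegaCensus.STPP222IcosetHSearchSound
import Mathlib.Tactic.IntervalCases

/-!
# ω-census, icoset class negatives at 2-rank four: semantics of the witness-model engine, I (primitives, `𝔽₂⁴` frame facts)

HONEST FRAMING (pub-omega census; verbatim): lottery ticket; floor = certified bounds/negative ranges.
Census STRUCTURE bookkeeping (Q7, the involution-coset class), nothing about `ω`.

Semantics of `STPP222IcosetWSearch.lean`, part I: the forcing / list primitives compute what their names say (`frc_eq`, `frcL_eq`,
`getI_setI`, …, `allBits16_true`, `popc16_eq_zero`, `someBit_eq_of_popc16`); and the finite geometry of `E = (𝔽₂⁴)*` in bit coordinates: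
for an independent frame `(a, b, c)` the point `ψ = psiB a b c` killing it, the three lines `L⁰ = Ann⟨a,b⟩`, `L¹ = Ann⟨b,c⟩`,
`L² = Ann⟨a,c⟩` (`onLB`, `lineSetB`), their coset representatives `lamTB`, and everything the engine relies on about them as ONE
kernel-decided Boolean `frameCheck` over all `2520` frames (`frame_facts`), unpacked into `psiB_spec`, `eq_psiB_of_kills`,
`rep_eq_lamTB`, `masksCore_spec`.  Part II (digit lists, `lamOf`, `feasF`, `tripInfo_sound`): `STPP222IcosetWSearchTriples.lean`;
part III (linear system, selection, the search, `vrefute`): `STPP222IcosetWSearchSound.lean`.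
Seat pub-omega-kernel-l4 (gen 20), 2026-08-27.
-/

namespace Summit.MatrixMultiplication.OmegaCensus

namespace IcosetW

open IcosetH (getI snoc allN getI_eq_getD allN_true)

/-! ## Primitives -/

/-- `cnd true x y = x`. -/ @[simp] theorem cnd_true {α : Type} (x y : α) : cnd true x y = x := rfl
/-- `cnd false x y = y`. -/ @[simp] theorem cnd_false {α : Type} (x y : α) : cnd false x y = y := rfl
/-- `cnd b x y = if b then x else y`. -/
theorem cnd_eq_ite {α : Type} (b : Bool) (x y : α) : cnd b x y = if b then x else y := by cases b <;> rfl
/-- `frc n f = f n`. -/ @[simp] theorem frc_eq {α : Type} (n : ℕ) (f : ℕ → α) : frc n f = f n := by cases n <;> rfl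
/-- `frcL l f = f l`. -/
@[simp] theorem frcL_eq {α : Type} (l : List ℕ) (f : List ℕ → α) : frcL l f = f l := by
  induction l generalizing f with
  | nil => rfl
  | cons x xs ih => cases x with
    | zero => exact ih _
    | succ k => exact ih _
/-- `minN = min`. -/
theorem minN_eq (x y : ℕ) : minN x y = min x y := by
  unfold minN; rw [cnd_eq_ite]
  by_cases h : x ≤ y
  · have hb : Nat.ble x y = true := Nat.ble_eq_true_of_le h
    simp [hb, h]
  · have hb : Nat.ble x y = false := by
      cases e : Nat.ble x y with
      | false => rfl
      | true => exact absurd (Nat.le_of_ble_eq_true e) h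
    simp [hb]; omega
/-- `lenL = List.length`. -/
@[simp] theorem lenL_eq (l : List ℕ) : lenL l = l.length := by
  induction l with | nil => rfl | cons x xs ih => exact congrArg (· + 1) ih
/-- `zerosL n = List.replicate n 0`. -/
@[simp] theorem zerosL_eq (n : ℕ) : zerosL n = List.replicate n 0 := by
  induction n with | zero => rfl | succ n ih => simp [zerosL, List.replicate_succ] at ih ⊢; exact ih
/-- Length of `setI`. -/
@[simp] theorem length_setI (l : List ℕ) (i v : ℕ) : (setI l i v).length = l.length := by
  induction l generalizing i with
  | nil => rfl
  | cons x xs ih => cases i with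
    | zero => rfl
    | succ j => exact congrArg (· + 1) (ih j)
/-- `setI` = `List.set`. -/
theorem setI_eq_set (l : List ℕ) (i v : ℕ) : setI l i v = l.set i v := by
  induction l generalizing i with
  | nil => rfl
  | cons x xs ih => cases i with
    | zero => rfl
    | succ j => exact congrArg (List.cons x) (ih j)
/-- Reading back a `setI`. -/
theorem getI_setI (l : List ℕ) (i j v : ℕ) (hi : i < l.length) :
    getI (setI l i v) j = if j = i then v else getI l j := by
  rw [setI_eq_set, getI_eq_getD, getI_eq_getD, List.getD_eq_getElem?_getD, List.getD_eq_getElem?_getD,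
    List.getElem?_set]
  by_cases h : j = i
  · subst h; simp [hi]
  · simp [Ne.symm h, h]
/-- `getI` of a cons at a successor. -/
@[simp] theorem getI_cons_succ (x : ℕ) (xs : List ℕ) (i : ℕ) : getI (x :: xs) (i + 1) = getI xs i := rfl
/-- `getI` of a cons at `0`. -/
@[simp] theorem getI_cons_zero (x : ℕ) (xs : List ℕ) : getI (x :: xs) 0 = x := rfl
/-- `getI` of a replicate of zeros is `0`. -/
@[simp] theorem getI_replicate_zero (n i : ℕ) : getI (List.replicate n 0) i = 0 := by
  rw [getI_eq_getD, List.getD_eq_getElem?_getD]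
  by_cases h : i < n
  · simp [h]
  · rw [List.getElem?_eq_none (by simpa using h)]; rfl
/-- `removeI` on a cons. -/
theorem removeI_cons (y : ℕ) (ys : List ℕ) (z : ℕ) :
    removeI (y :: ys) z = if Nat.beq y z = true then ys else y :: removeI ys z := by
  show cnd (Nat.beq y z) ys (y :: removeI ys z) = _; rw [cnd_eq_ite]

/-- Members of `removeI l z` are members of `l`. -/
theorem mem_of_mem_removeI {l : List ℕ} {z x : ℕ} (h : x ∈ removeI l z) : x ∈ l := by
  induction l with
  | nil => exact absurd h (by simp [removeI])
  | cons y ys ih =>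
    rw [removeI_cons] at h
    split_ifs at h with hy
    · exact List.mem_cons_of_mem _ h
    · rcases List.mem_cons.1 h with rfl | h
      · exact List.mem_cons_self
      · exact List.mem_cons_of_mem _ (ih h)
/-- `allBits16 m p = true` gives `p u = true` for every set bit `u < 16` of `m`. -/
theorem allBits16_true {m : ℕ} {p : ℕ → Bool} (h : allBits16 m p = true) {u : ℕ} (hu : u < 16)
    (hm : Nat.testBit m u = true) : p u = true := by
  unfold allBits16 at h
  suffices H : ∀ n, (@Nat.rec (fun _ => Bool) true (fun i acc => acc && (!(Nat.testBit m i) || p i)) n) = true →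
      ∀ u, u < n → Nat.testBit m u = true → p u = true from H 16 h u hu hm
  intro n
  induction n with
  | zero => intro _ u hu; exact absurd hu (Nat.not_lt_zero _)
  | succ n ih =>
    intro h u hu hmu
    simp only [Bool.and_eq_true, Bool.or_eq_true, Bool.not_eq_true'] at h
    rcases Nat.lt_succ_iff_lt_or_eq.1 hu with hlt | rfl
    · exact ih h.1 u hlt hmu
    · rcases h.2 with h2 | h2
      · rw [hmu] at h2; exact absurd h2 (by decide)
      · exact h2

/-- Membership of a point in a bit mask. [folklore] -/
def Mem (m u : ℕ) : Prop := Nat.testBit m u = true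

/-- `bit i = 2 ^ i`. -/
theorem bit_eq (i : ℕ) : bit i = 2 ^ i := by show 1 <<< i = 2 ^ i; rw [Nat.shiftLeft_eq, one_mul]

/-- Membership in `bit i`. -/
theorem mem_bit {i u : ℕ} : Mem (bit i) u ↔ u = i := by
  unfold Mem; rw [bit_eq, Nat.testBit_two_pow]; simp [eq_comm]

/-- Membership in a `lor`. -/
theorem mem_lor {a b u : ℕ} : Mem (Nat.lor a b) u ↔ Mem a u ∨ Mem b u := by
  unfold Mem; show (a ||| b).testBit u = true ↔ _; rw [Nat.testBit_or]; simp

/-- Membership in a `land`. -/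
theorem mem_land {a b u : ℕ} : Mem (Nat.land a b) u ↔ Mem a u ∧ Mem b u := by
  unfold Mem; show (a &&& b).testBit u = true ↔ _; rw [Nat.testBit_and]; simp

/-- Kernel evaluation: below `2¹⁶`, `popc16 = 0` only at `0`. -/
theorem popc16_zero_check : (allN 65536 fun m => !(Nat.beq (popc16 m) 0) || Nat.beq m 0) = true := by decide +kernel

/-- A number below `2¹⁶` with `popc16 = 0` is `0`. -/
theorem popc16_eq_zero {m : ℕ} (hm : m < 65536) (h : popc16 m = 0) : m = 0 := by
  have := allN_true popc16_zero_check hm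
  simp only [Bool.or_eq_true, Bool.not_eq_true', h] at this
  simpa using this

/-- Kernel evaluation: below `2¹⁶`, a mask with `popc16 = 1` has `someBit` equal to each of its set bits. -/
theorem someBit_check : (allN 65536 fun m => !(Nat.beq (popc16 m) 1) ||
    allN 16 fun ψ => !(Nat.testBit m ψ) || Nat.beq (someBit m) ψ) = true := by decide +kernel

/-- A mask below `2¹⁶` with exactly one set bit (`popc16 = 1`) containing `ψ < 16` has `someBit = ψ`. -/
theorem someBit_eq_of_popc16 {m : ℕ} (hm : m < 65536) (h : popc16 m = 1) {ψ : ℕ} (hψ : ψ < 16)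
    (hb : Nat.testBit m ψ = true) : someBit m = ψ := by
  have := allN_true someBit_check hm
  simp only [Bool.or_eq_true, Bool.not_eq_true', h] at this
  rcases this with h1 | h1
  · exact absurd h1 (by decide)
  · have := allN_true h1 hψ
    simp only [Bool.or_eq_true, Bool.not_eq_true', Nat.beq_eq, hb] at this
    rcases this with h2 | h2
    · exact absurd h2 (by decide)
    · exact h2

/-- A member of a mask makes it non-zero. -/
theorem ne_zero_of_mem {m u : ℕ} (h : Mem m u) : m ≠ 0 := by rintro rfl; simp [Mem] at h

/-! ## `𝔽₂⁴` in bits: frames, the killing point, lines, coset representatives -/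

/-- `u` kills `v`: `u(v) = 0`. -/
noncomputable def kills (u v : ℕ) : Bool := !(ev u v)

/-- Independence of a frame `(a, b, c)` of 4-bit vectors: all seven non-trivial `𝔽₂`-combinations are non-zero. -/
noncomputable def indepB (a b c : ℕ) : Bool :=
  !(Nat.beq a 0) && !(Nat.beq b 0) && !(Nat.beq c 0) && !(Nat.beq a b) && !(Nat.beq a c) && !(Nat.beq b c) &&
    !(Nat.beq (Nat.xor (Nat.xor a b) c) 0)

/-- The point `ψ` of a frame: the (largest, in fact unique) non-zero functional killing `a`, `b`, `c`. -/
noncomputable def psiB (a b c : ℕ) : ℕ :=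
  @Nat.rec (fun _ => ℕ) 0 (fun u acc => cnd (kills (u + 1) a && kills (u + 1) b && kills (u + 1) c) (u + 1) acc) 15

/-- `u` lies on line `X` of the frame (`X = 0`: kills `a, b`; `X = 1`: kills `b, c`; `X = 2`: kills `a, c`), `u ≠ 0`. -/
noncomputable def onLB (X a b c u : ℕ) : Bool :=
  !(Nat.beq u 0) && cnd (Nat.beq X 0) (kills u a && kills u b) (cnd (Nat.beq X 1) (kills u b && kills u c) (kills u a && kills u c))

/-- The coset representative (mod `ψ`) common to the points `≠ ψ` of line `X` (computed from the largest such point). -/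
noncomputable def lamTB (X a b c : ℕ) : ℕ :=
  rep (@Nat.rec (fun _ => ℕ) 0 (fun u acc => cnd (onLB X a b c (u + 1) && !(Nat.beq (u + 1) (psiB a b c))) (u + 1) acc) 15)
    (psiB a b c)

/-- Bit mask of the points `< n` of line `X` of the frame. -/
noncomputable def lineRec (X a b c n : ℕ) : ℕ :=
  @Nat.rec (fun _ => ℕ) 0 (fun u acc => cnd (onLB X a b c u) (Nat.lor acc (bit u)) acc) n

/-- Bit mask of line `X` of the frame. -/
noncomputable def lineSetB (X a b c : ℕ) : ℕ := lineRec X a b c 16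

/-- `A ⊆ B` for bit masks below `2¹⁶`. -/
noncomputable def subMask (A B : ℕ) : Bool := Nat.beq (Nat.land A B) A

/-- The body of `masksAt` as a function of `ψ` and the three line representatives (`masksAt_eq`). -/
noncomputable def masksCore (ψ l0 l1 l2 : ℕ) : ℕ :=
  cnd (Nat.beq l0 16 || Nat.beq l1 16 || Nat.beq l2 16 ||
      (!(Nat.beq l0 0) && Nat.beq l0 l1) || (!(Nat.beq l1 0) && Nat.beq l1 l2) || (!(Nat.beq l0 0) && Nat.beq l0 l2) ||
      (!(Nat.beq l0 0) && !(Nat.beq l1 0) && !(Nat.beq l2 0) &&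
        (Nat.beq (Nat.xor (Nat.xor l0 l1) l2) 0 || Nat.beq (Nat.xor (Nat.xor l0 l1) l2) ψ)))
    0
    (Nat.add (Nat.add (lineMask ψ l0 l1 l2) (Nat.add (Nat.mul (lineMask ψ l1 l0 l2) 65536)
      (Nat.mul (lineMask ψ l2 l0 l1) 4294967296))) 281474976710656)

/-- `masksAt` factors through the three `lamOf`. -/
theorem masksAt_eq (ψ p0 p1 p2 : ℕ) : masksAt ψ p0 p1 p2 = masksCore ψ (lamOf ψ p0) (lamOf ψ p1) (lamOf ψ p2) := by
  unfold masksAt masksCore; simp only [frc_eq]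

/-- Everything the search needs about ONE frame, as a kernel-decidable Boolean: the point `ψ` is a point killing the frame and
the only one; each line's representative is a point `≠ ψ`'s class shared by the whole line; the representatives are pairwise
distinct and not coplanar; and for each of the eight "which representatives are recorded" patterns the engine's `masksCore` at
the true `ψ` is alive and its three masks contain the three true lines. -/
noncomputable def frameCheck (a b c : ℕ) : Bool :=
  let ψ := psiB a b c
  let l0 := lamTB 0 a b c
  let l1 := lamTB 1 a b c
  let l2 := lamTB 2 a b c
  !(Nat.beq ψ 0) && Nat.blt ψ 16 && kills ψ a && kills ψ b && kills ψ c &&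
  (allN 16 fun u => !(kills u a && kills u b && kills u c) || Nat.beq u 0 || Nat.beq u ψ) &&
  !(Nat.beq l0 0) && Nat.blt l0 16 && !(Nat.beq l1 0) && Nat.blt l1 16 && !(Nat.beq l2 0) && Nat.blt l2 16 &&
  (allN 16 fun u => (!(onLB 0 a b c u) || Nat.beq u ψ || Nat.beq (rep u ψ) l0) &&
    (!(onLB 1 a b c u) || Nat.beq u ψ || Nat.beq (rep u ψ) l1) && (!(onLB 2 a b c u) || Nat.beq u ψ || Nat.beq (rep u ψ) l2)) &&
  (allN 2 fun e0 => allN 2 fun e1 => allN 2 fun e2 =>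
    let r := masksCore ψ (Nat.mul e0 l0) (Nat.mul e1 l1) (Nat.mul e2 l2)
    !(Nat.beq r 0) && Nat.blt r 562949953421312 &&
      subMask (lineSetB 0 a b c) (Nat.mod r 65536) && subMask (lineSetB 1 a b c) (Nat.mod (Nat.div r 65536) 65536) &&
      subMask (lineSetB 2 a b c) (Nat.mod (Nat.div r 4294967296) 65536))

/-- Kernel evaluation of `frameCheck` over all `2520` independent frames of `𝔽₂⁴`. -/
theorem frame_check_all :
    (allN 16 fun a => allN 16 fun b => allN 16 fun c => !(indepB a b c) || frameCheck a b c) = true := by decide +kernel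

/-- **Frame facts**: `frameCheck` holds for every independent frame. -/
theorem frame_facts {a b c : ℕ} (ha : a < 16) (hb : b < 16) (hc : c < 16) (hi : indepB a b c = true) :
    frameCheck a b c = true := by
  have := allN_true (allN_true (allN_true frame_check_all ha) hb) hc
  simp only [Bool.or_eq_true, Bool.not_eq_true', hi] at this
  rcases this with h | h
  · exact absurd h (by decide)
  · exact h

/-! ## Unpacking the frame facts -/

section Frame
variable {a b c : ℕ} (ha : a < 16) (hb : b < 16) (hc : c < 16) (hi : indepB a b c = true)
include ha hb hc hi


/-- `ψ` of an independent frame is a point `1 … 15` killing `a`, `b`, `c`. -/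
theorem psiB_spec : psiB a b c ≠ 0 ∧ psiB a b c < 16 ∧ kills (psiB a b c) a = true ∧ kills (psiB a b c) b = true ∧
    kills (psiB a b c) c = true := by
  have h := frame_facts ha hb hc hi
  unfold frameCheck at h
  simp only [Bool.and_eq_true, Bool.not_eq_true', Nat.blt_eq] at h
  obtain ⟨⟨⟨⟨⟨⟨⟨⟨⟨⟨⟨⟨⟨h1, h2⟩, h3⟩, h4⟩, h5⟩, -⟩, -⟩, -⟩, -⟩, -⟩, -⟩, -⟩, -⟩, -⟩ := h
  exact ⟨Nat.ne_of_beq_eq_false h1, h2, h3, h4, h5⟩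

/-- The ONLY non-zero functional killing `a`, `b`, `c` is `ψ`. -/
theorem eq_psiB_of_kills {u : ℕ} (hu : u < 16) (h0 : u ≠ 0) (ka : kills u a = true) (kb : kills u b = true)
    (kc : kills u c = true) : u = psiB a b c := by
  have h := frame_facts ha hb hc hi
  unfold frameCheck at h
  simp only [Bool.and_eq_true, Bool.not_eq_true', Nat.blt_eq] at h
  obtain ⟨⟨⟨⟨⟨⟨⟨⟨⟨-, h6⟩, -⟩, -⟩, -⟩, -⟩, -⟩, -⟩, -⟩, -⟩ := h
  have := allN_true h6 hu
  rw [ka, kb, kc] at this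
  simp only [Bool.and_self, Bool.not_true, Bool.false_or, Bool.or_eq_true, Nat.beq_eq] at this
  rcases this with h | h
  · exact absurd h h0
  · exact h

/-- The line representatives are points `1 … 15`. -/
theorem lamTB_spec : (lamTB 0 a b c ≠ 0 ∧ lamTB 0 a b c < 16) ∧ (lamTB 1 a b c ≠ 0 ∧ lamTB 1 a b c < 16) ∧
    (lamTB 2 a b c ≠ 0 ∧ lamTB 2 a b c < 16) := by
  have h := frame_facts ha hb hc hi
  unfold frameCheck at h
  simp only [Bool.and_eq_true, Bool.not_eq_true', Nat.blt_eq] at h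
  obtain ⟨⟨⟨⟨⟨⟨⟨⟨-, h7⟩, h8⟩, h9⟩, h10⟩, h11⟩, h12⟩, -⟩, -⟩ := h
  exact ⟨⟨Nat.ne_of_beq_eq_false h7, h8⟩, ⟨Nat.ne_of_beq_eq_false h9, h10⟩, ⟨Nat.ne_of_beq_eq_false h11, h12⟩⟩

/-- Every point of line `X` other than `ψ` has coset representative `lamTB X`. -/
theorem rep_eq_lamTB {X u : ℕ} (hX : X < 3) (hu : u < 16) (hon : onLB X a b c u = true) (hne : u ≠ psiB a b c) :
    rep u (psiB a b c) = lamTB X a b c := by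
  have h := frame_facts ha hb hc hi
  unfold frameCheck at h
  simp only [Bool.and_eq_true, Bool.not_eq_true', Nat.blt_eq] at h
  obtain ⟨⟨-, h13⟩, -⟩ := h
  have := allN_true h13 hu
  simp only [Bool.and_eq_true, Bool.or_eq_true, Bool.not_eq_true', Nat.beq_eq] at this
  obtain ⟨⟨h0, h1⟩, h2⟩ := this
  interval_cases X
  · rcases h0 with (h | h) | h
    · rw [hon] at h; exact absurd h (by decide)
    · exact absurd h hne
    · exact h
  · rcases h1 with (h | h) | h
    · rw [hon] at h; exact absurd h (by decide)
    · exact absurd h hne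
    · exact h
  · rcases h2 with (h | h) | h
    · rw [hon] at h; exact absurd h (by decide)
    · exact absurd h hne
    · exact h

/-- The engine's masks at the true `ψ` for any "recorded representatives" pattern `e ∈ {0,1}³`: alive, below `2⁴⁹`, and the three
masks contain the three lines. -/
theorem masksCore_spec {e0 e1 e2 : ℕ} (h0 : e0 < 2) (h1 : e1 < 2) (h2 : e2 < 2) :
    let r := masksCore (psiB a b c) (e0 * lamTB 0 a b c) (e1 * lamTB 1 a b c) (e2 * lamTB 2 a b c)
    r ≠ 0 ∧ r < 562949953421312 ∧ subMask (lineSetB 0 a b c) (r % 65536) = true ∧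
      subMask (lineSetB 1 a b c) (r / 65536 % 65536) = true ∧ subMask (lineSetB 2 a b c) (r / 4294967296 % 65536) = true := by
  have h := frame_facts ha hb hc hi
  unfold frameCheck at h
  simp only [Bool.and_eq_true, Bool.not_eq_true', Nat.blt_eq] at h
  obtain ⟨-, h14⟩ := h
  have := allN_true (allN_true (allN_true h14 h0) h1) h2
  simp only [Bool.and_eq_true, Bool.not_eq_true', Nat.blt_eq] at this
  obtain ⟨⟨⟨⟨hr0, hr1⟩, hs0⟩, hs1⟩, hs2⟩ := this
  exact ⟨Nat.ne_of_beq_eq_false hr0, hr1, hs0, hs1, hs2⟩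

end Frame

/-- One step of `lineRec`. -/
theorem lineRec_succ (X a b c n : ℕ) :
    lineRec X a b c (n + 1) = if onLB X a b c n = true then Nat.lor (lineRec X a b c n) (bit n) else lineRec X a b c n := by
  show cnd (onLB X a b c n) (Nat.lor (lineRec X a b c n) (bit n)) (lineRec X a b c n) = _; rw [cnd_eq_ite]

/-- The points `u < n` of line `X` are members of `lineRec … n`. -/
theorem mem_lineRec {X a b c u : ℕ} (hon : onLB X a b c u = true) : ∀ n, u < n → Mem (lineRec X a b c n) u := by
  intro n
  induction n with
  | zero => intro h; exact absurd h (Nat.not_lt_zero _)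
  | succ n ih =>
    intro hun
    rw [lineRec_succ]
    rcases Nat.lt_succ_iff_lt_or_eq.1 hun with hlt | rfl
    · split_ifs
      · exact mem_lor.2 (Or.inl (ih hlt))
      · exact ih hlt
    · rw [if_pos hon]; exact mem_lor.2 (Or.inr (mem_bit.2 rfl))

/-- Members of `lineSetB X` include every `u < 16` on line `X`. -/
theorem mem_lineSetB {X a b c u : ℕ} (hu : u < 16) (hon : onLB X a b c u = true) : Mem (lineSetB X a b c) u :=
  mem_lineRec hon 16 hu

/-- `subMask A B` transfers membership. -/
theorem mem_of_subMask {A B u : ℕ} (h : subMask A B = true) (hA : Mem A u) : Mem B u := by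
  unfold subMask at h; simp only [Nat.beq_eq] at h
  have : Mem (Nat.land A B) u := by rw [h]; exact hA
  exact (mem_land.1 this).2

end IcosetW

end Summit.MatrixMultiplication.OmegaCensus
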